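import Literature.Barriers.FinalStateConjecture.TrappingDerivativeLossGeodesicBeamsChart
import Literature.Analysis.ODE.GaussianBeamRiccatiExistence
import HarnessLib

/-!
# Gaussian beams along a null geodesic of Kerr, II: momentum, Hamilton's equations and the
# Jacobi data along the geodesic

(second proof file towards `KerrNullGeodesicGaussianBeams_holds`,
`Literature/Barriers/FinalStateConjecture/TrappingDerivativeLossGeodesicBeams.lean`; family `gr`,
summit `FinalStateConjecture`; namespace `Literature.Barriers.FinalStateConjecture.GaussianBeam`)

Sbierski's construction of the phase of a Gaussian beam along a null geodesic `γ`
(Anal. PDE 8 (2015), §3 = arXiv:1311.2477 §2.2) works with the lift `s ↦ γ̇♭(s)` of `γ` to the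
cotangent bundle: "`dφ(s) := γ̇♭(s)`" ((2.14) of the arXiv text), "`γ` […] satisfies the equations
of the geodesic flow on `T*M`" (p. 12), and the matrices `A = ∂²H/∂x∂x`, `B = ∂²H/∂x∂p`,
`C = ∂²H/∂p∂p` of the Hamiltonian `H = ½ g^{μν}(x) p_μ p_ν` along the lift ((2.17)–(2.19)), for
which "`s ↦ σ̇(s)`" — the tangent `(γ̇, (dφ)˙)` of the lift — "is a solution of (2.20)", the
linearised (Jacobi) system `J̇ = BᵀJ + CV`, `V̇ = −AJ − BV` ((2.26)). This file proves these
statements for an arbitrary geodesic of the Kerr exterior read in the ingoing Kerr–Schild chart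
(previous file), as the input of the abstract Riccati theorem
`Literature.Analysis.ODE.GaussianBeamRiccati.exists_riccati`:

* `momentum` (`p_μ = g(γ̇, ∂_μ)`), `vel_eq_sum` (`γ̇^ρ = g^{ρν} p_ν`), `hasDerivAt_momentum`
  (`ṗ_μ = ½ ∂_μ g(γ̇, γ̇)`), `fderiv_bilin_vel_vel_eq` (`∂_κ g(γ̇, γ̇) = −∂_κ g⁻¹(p, p)`), whence
  Hamilton's equation `ṗ = −∂H/∂x` (`momentumRHS`, `hasDerivAt_momentum'`);
* `dInv`, `ddInv` (`∂_κ g^{μν}`, `∂_l∂_κ g^{μν}`, symmetric by Schwarz, `ddInv_symm`), Sbierski's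
  `jacobiA`, `jacobiB`, `jacobiC` (`A = ½ ∂∂g⁻¹(p,p)`, `B = ∂g⁻¹(p, ·)`, `C = g⁻¹`; `A`, `C`
  symmetric), and **the tangent `(γ̇, ṗ)` of the lift solves the Jacobi system**
  (`hasDerivAt_vel_jacobi`: `γ̈ = Bᵀγ̇ + Cṗ`; `hasDerivAt_momentumRHS`: `p̈ = −Aγ̇ − Bṗ`);
  smoothness of all these data in `s` (`contDiff_momentum`, `contDiff_jacobiA`, …);
* `initialHessian x₀ ξ₀ = R + i LᵀL` — an explicit initial value `M(0)` meeting Sbierski's three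
  requirements (symmetric; `M(0) x₀ = ξ₀`; `Im M(0) ≥ 0` with kernel exactly `ℂ x₀`, for
  `x₀⁰ ≠ 0`), `L` the shear `(Lf)_i = f_{i+1} − (x₀^{i+1}/x₀⁰) f_0`
  (`imForm_initialHessian`: the Hermitian form of `Im M(0)` is `∑_i |(Lf)_i|²`);
* `exists_phaseHessian`, `phaseHessian` — **the Hessian `M(s)` of the phase along `γ`**:
  the abstract theorem `GaussianBeamRiccati.exists_riccati` applied to these data (complexified:
  `velC`, `momentumRHSC`, `jacobiAC/BC/CC`): symmetric, Riccati equation, `M γ̇ = ṗ`,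
  `Im M ≥ 0` with kernel `ℂ γ̇(s)`, `C^∞` entries;
* `imBlockForm`, `imBlockForm_pos`, `exists_imBlockForm_ge` — **transversal positivity**: the
  imaginary part of the spatial block `(M_{i+1,j+1})` is positive definite on `ℝ³` (the kernel line
  `γ̇` has `γ̇⁰ > 0`), uniformly on compact parameter intervals (Sbierski's constant `c` in
  `Im φ ≥ c |x̲|²`, (2.13)).

Everything is proved; the helper definitions have bodies; no named facts are introduced.

## References

* J. Sbierski, Anal. PDE 8 (2015) 1379–1420 (arXiv:1311.2477), §2.2 of the arXiv text,
  (2.14)–(2.27) (key `Sbierski2015`).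
* B. O'Neill, *Semi-Riemannian geometry*, Academic Press 1983, Ch. 3, Prop. 13, Cor. 21
  (key `ONeill1983`).
-/

noncomputable section

open Bundle Set Filter Function TopologicalSpace
open scoped Manifold ContDiff Topology Matrix

namespace Literature.Barriers.FinalStateConjecture

namespace GaussianBeam

open Literature.Geometry.Lorentzian

/-! ### Linear algebra of the coordinate basis of `E4` -/

/-- Expansion of a continuous linear functional on `E4`: `ℓ(u) = ∑_ν u^ν ℓ(∂_ν)`. [folklore] -/
theorem clm_apply_eq_sum (ℓ : E4 →L[ℝ] ℝ) (u : E4) :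
    ℓ u = ∑ ν, u ν * ℓ (E4.basisVector ν) := by
  conv_lhs => rw [Kerr.eq_sum_basisVector u, map_sum]
  refine Finset.sum_congr rfl fun ν _ ↦ ?_
  rw [map_smul, smul_eq_mul]

/-- Expansion of a continuous bilinear form on `E4` in the coordinate basis:
`D(u, w) = ∑_{νβ} u^ν w^β D(∂_ν, ∂_β)`. [folklore] -/
theorem clm₂_apply_eq_sum (D : E4 →L[ℝ] E4 →L[ℝ] ℝ) (u w : E4) :
    D u w = ∑ ν, ∑ β, u ν * w β * D (E4.basisVector ν) (E4.basisVector β) := by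
  rw [clm_apply_eq_sum (D u) w]
  have h : ∀ β, D u (E4.basisVector β) = ∑ ν, u ν * D (E4.basisVector ν) (E4.basisVector β) := by
    intro β
    rw [← ContinuousLinearMap.flip_apply D, clm_apply_eq_sum (D.flip (E4.basisVector β)) u]
    simp only [ContinuousLinearMap.flip_apply]
  simp_rw [h, Finset.mul_sum]
  rw [Finset.sum_comm]
  exact Finset.sum_congr rfl fun ν _ ↦ Finset.sum_congr rfl fun β _ ↦ by ring

/-! ### Velocity and momentum of a curve in the Kerr exterior -/

section Momentum

variable {M a : ℝ}

/-- The velocity of a curve `γ` of the Kerr exterior as a vector of `E4` (the prelude's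
`velocity`, retyped from the tangent space `T_{γ s} = E4`). [folklore] -/
def vel (γ : ℝ → Kerr.exterior M a) (s : ℝ) : E4 := velocity 𝓘(ℝ, E4) γ s

/-- Unfolding lemma for `vel`. [folklore] -/
theorem vel_def (γ : ℝ → Kerr.exterior M a) (s : ℝ) : vel γ s = velocity 𝓘(ℝ, E4) γ s := rfl

variable (M a) in
/-- **The momentum covector of a curve of the Kerr exterior**, `p_μ(s) = g_{γ(s)}(γ̇(s), ∂_μ)`,
i.e. `p = γ̇♭` in the coordinate basis; along a null geodesic this is Sbierski's `dφ(s) := γ̇♭(s)`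
(arXiv:1311.2477, §2.2, (2.14)). [cite: Sbierski2015, §3 (arXiv §2.2, (2.14))] -/
def momentum (γ : ℝ → Kerr.exterior M a) (s : ℝ) (μ : Fin 4) : ℝ :=
  Kerr.bilin M a (γ s) (vel γ s) (E4.basisVector μ)

/-- `g(γ̇, w) = ∑_μ w^μ p_μ`: the momentum is the covector `γ̇♭`. [folklore] -/
theorem bilin_vel_eq_sum (γ : ℝ → Kerr.exterior M a) (s : ℝ) (w : E4) :
    Kerr.bilin M a (γ s) (vel γ s) w = ∑ μ, w μ * momentum M a γ s μ := by
  unfold momentum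
  exact clm_apply_eq_sum (Kerr.bilin M a (γ s) (vel γ s)) w

/-- **Raising the index: `γ̇^ρ = ∑_ν g^{ρν} p_ν`** (`g⁻¹ g = 1` in Kerr–Schild components,
`Kerr.sum_inverseMetric_mul_bilin`), i.e. Hamilton's first equation `ẋ = ∂H/∂p` for
`H = ½ g^{μν} p_μ p_ν` along the lift `(γ, γ̇♭)` (Sbierski, arXiv:1311.2477, §2.2, p. 12, the
equations of the geodesic flow on `T*M`). [cite: Sbierski2015, §3 (arXiv §2.2, p. 12)] -/
theorem vel_eq_sum (γ : ℝ → Kerr.exterior M a) (s : ℝ) (ρ : Fin 4) :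
    vel γ s ρ = ∑ ν, Kerr.inverseMetric M a (γ s) ρ ν * momentum M a γ s ν := by
  have hx := Kerr.radius_pos_of_mem_region (γ s).2
  have hp : ∀ ν, momentum M a γ s ν =
      ∑ κ, vel γ s κ * Kerr.bilin M a (γ s) (E4.basisVector ν) (E4.basisVector κ) := by
    intro ν
    unfold momentum
    rw [Kerr.bilin_eq_sum_apply]
    exact Finset.sum_congr rfl fun κ _ ↦ by rw [Kerr.bilin_symm]
  simp_rw [hp, Finset.mul_sum]
  rw [Finset.sum_comm]
  have h2 : ∀ κ, ∑ ν, Kerr.inverseMetric M a (γ s) ρ ν *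
      (vel γ s κ * Kerr.bilin M a (γ s) (E4.basisVector ν) (E4.basisVector κ)) =
      vel γ s κ * ∑ ν, Kerr.inverseMetric M a (γ s) ρ ν *
        Kerr.bilin M a (γ s) (E4.basisVector ν) (E4.basisVector κ) := by
    intro κ
    rw [Finset.mul_sum]
    exact Finset.sum_congr rfl fun ν _ ↦ by ring
  simp_rw [h2, Kerr.sum_inverseMetric_mul_bilin M a hx]
  simp [Finset.sum_ite_eq, mul_ite]

/-- **`∂_κ g(γ̇, γ̇) = −∂_κ g⁻¹(p, p)`**: the derivative of the inverse metric paired with the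
momentum is minus the derivative of the metric paired with the velocity (differentiate
`g⁻¹ g = 1`, `Kerr.sum_fderiv_inverseMetric_mul_bilin`, and raise indices with `vel_eq_sum`). This
identifies `½ ∂_κ g(γ̇, γ̇)` with `−∂H/∂x^κ`, `H = ½ g^{μν} p_μ p_ν`. [folklore] -/
theorem fderiv_bilin_vel_vel_eq (γ : ℝ → Kerr.exterior M a) (s : ℝ) (κ : Fin 4) :
    fderiv ℝ (Kerr.bilin M a) (γ s) (E4.basisVector κ) (vel γ s) (vel γ s) =
      -∑ μ, ∑ ν, fderiv ℝ (fun y ↦ Kerr.inverseMetric M a y μ ν) (γ s) (E4.basisVector κ) *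
        momentum M a γ s μ * momentum M a γ s ν := by
  have hx := Kerr.radius_pos_of_mem_region (γ s).2
  set x : E4 := (γ s : E4) with hx_def
  set v : E4 := vel γ s with hv_def
  set p : Fin 4 → ℝ := momentum M a γ s with hp_def
  set D : E4 →L[ℝ] E4 →L[ℝ] ℝ := fderiv ℝ (Kerr.bilin M a) x (E4.basisVector κ) with hD
  set gI : Fin 4 → Fin 4 → ℝ := fun μ ν ↦ Kerr.inverseMetric M a x μ ν with hgI
  set dgI : Fin 4 → Fin 4 → ℝ := fun μ ν ↦
    fderiv ℝ (fun y ↦ Kerr.inverseMetric M a y μ ν) x (E4.basisVector κ) with hdgI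
  -- `p_ν = ∑_β v^β g(∂_ν, ∂_β)`
  have hp : ∀ ν, p ν = ∑ β, v β * Kerr.bilin M a x (E4.basisVector ν) (E4.basisVector β) := by
    intro ν
    simp only [hp_def, momentum]
    rw [Kerr.bilin_eq_sum_apply]
    exact Finset.sum_congr rfl fun β _ ↦ by rw [Kerr.bilin_symm]
  -- `∑_ν ∂g^{μν} p_ν = −∑_β v^β ∑_ν g^{μν} ∂g(∂_ν, ∂_β)`
  have h1 : ∀ μ, ∑ ν, dgI μ ν * p ν =
      -∑ β, v β * ∑ ν, gI μ ν * D (E4.basisVector ν) (E4.basisVector β) := by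
    intro μ
    have hswap : ∑ ν, dgI μ ν * p ν =
        ∑ β, v β * ∑ ν, dgI μ ν * Kerr.bilin M a x (E4.basisVector ν) (E4.basisVector β) := by
      simp_rw [hp, Finset.mul_sum]
      rw [Finset.sum_comm]
      exact Finset.sum_congr rfl fun β _ ↦ Finset.sum_congr rfl fun ν _ ↦ by ring
    rw [hswap, ← Finset.sum_neg_distrib]
    refine Finset.sum_congr rfl fun β _ ↦ ?_
    rw [show (∑ ν, dgI μ ν * Kerr.bilin M a x (E4.basisVector ν) (E4.basisVector β)) =
      -∑ ν, gI μ ν * D (E4.basisVector ν) (E4.basisVector β) from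
      Kerr.sum_fderiv_inverseMetric_mul_bilin M a hx (E4.basisVector κ) μ β]
    ring
  -- `∑_μ g^{μν} p_μ = v^ν`
  have h2 : ∀ ν, ∑ μ, gI μ ν * p μ = v ν := by
    intro ν
    rw [hv_def, vel_eq_sum γ s ν]
    exact Finset.sum_congr rfl fun μ _ ↦ by rw [Kerr.inverseMetric_symm]
  -- assemble
  calc D v v = ∑ ν, ∑ β, v ν * v β * D (E4.basisVector ν) (E4.basisVector β) :=
        clm₂_apply_eq_sum D v v
    _ = ∑ ν, ∑ β, (∑ μ, gI μ ν * p μ) * v β * D (E4.basisVector ν) (E4.basisVector β) := by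
        simp_rw [h2]
    _ = ∑ μ, p μ * ∑ β, v β * ∑ ν, gI μ ν * D (E4.basisVector ν) (E4.basisVector β) := by
        simp_rw [Finset.sum_mul, Finset.mul_sum]
        rw [Finset.sum_congr rfl fun ν _ ↦ Finset.sum_comm, Finset.sum_comm]
        refine Finset.sum_congr rfl fun μ _ ↦ ?_
        rw [Finset.sum_comm]
        exact Finset.sum_congr rfl fun β _ ↦ Finset.sum_congr rfl fun ν _ ↦ by ring
    _ = -∑ μ, ∑ ν, dgI μ ν * p μ * p ν := by
        rw [← Finset.sum_neg_distrib]
        refine Finset.sum_congr rfl fun μ _ ↦ ?_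
        have h := h1 μ
        have h' : ∑ ν, dgI μ ν * p μ * p ν = p μ * ∑ ν, dgI μ ν * p ν := by
          rw [Finset.mul_sum]
          exact Finset.sum_congr rfl fun ν _ ↦ by ring
        rw [h', h]
        ring

end Momentum

/-! ### Hamilton's equations along a geodesic of the Kerr exterior -/

section Hamilton

variable [Kerr.Facts] [Kerr.SliceFacts] {M a : ℝ}

omit [Kerr.Facts] [Kerr.SliceFacts] in
/-- `g(Γ_x(Y, X), w) = ½ K_x(Y, X, w)` for the plain Christoffel map of the Kerr–Schild components
(`Kerr.bilin_coSharp`: `coSharp` inverts `♭`). O'Neill 1983, Ch. 3, Prop. 13.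
[cite: ONeill1983, Ch. 3, Prop. 3.13] -/
theorem bilin_christoffelVec {x : E4} (hx : 0 < Kerr.radius a x) (Y X w : E4) :
    Kerr.bilin M a x (christoffelVec M a x Y X) w = koszulHalf M a x Y X w := by
  unfold christoffelVec
  rw [Kerr.bilin_coSharp M a hx, smul_koszulForm_apply]

/-- The coordinate curve of a geodesic has derivative `vel` (retyped `geodesic_hasDerivAt`).
[cite: ONeill1983, Ch. 3, Cor. 21] -/
theorem hasDerivAt_pos {γ : ℝ → Kerr.exterior M a}
    (hγ : IsGeodesic (Kerr.smoothMetric M a (Kerr.rPlus M a)).leviCivita γ) (s : ℝ) :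
    HasDerivAt (fun t ↦ (γ t : E4)) (vel γ s) s :=
  (geodesic_hasDerivAt M a hγ s).1

/-- The velocity of a geodesic has derivative `−Γ(γ̇, γ̇)` (retyped `geodesic_hasDerivAt`).
[cite: ONeill1983, Ch. 3, Cor. 21] -/
theorem hasDerivAt_vel {γ : ℝ → Kerr.exterior M a}
    (hγ : IsGeodesic (Kerr.smoothMetric M a (Kerr.rPlus M a)).leviCivita γ) (s : ℝ) :
    HasDerivAt (vel γ) (-christoffelVec M a (γ s) (vel γ s) (vel γ s)) s :=
  (geodesic_hasDerivAt M a hγ s).2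

/-- The coordinate curve of a geodesic is `C^∞` (retyped `geodesic_contDiff`).
[cite: ONeill1983, Ch. 3, Cor. 21] -/
theorem contDiff_pos {γ : ℝ → Kerr.exterior M a}
    (hγ : IsGeodesic (Kerr.smoothMetric M a (Kerr.rPlus M a)).leviCivita γ) :
    ContDiff ℝ ∞ (fun t ↦ (γ t : E4)) :=
  (geodesic_contDiff M a hγ).1

/-- The velocity of a geodesic is `C^∞` (retyped `geodesic_contDiff`).
[cite: ONeill1983, Ch. 3, Cor. 21] -/
theorem contDiff_vel {γ : ℝ → Kerr.exterior M a}
    (hγ : IsGeodesic (Kerr.smoothMetric M a (Kerr.rPlus M a)).leviCivita γ) :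
    ContDiff ℝ ∞ (vel γ) :=
  (geodesic_contDiff M a hγ).2

/-- Components of the velocity have the components of `−Γ(γ̇, γ̇)` as derivatives. [folklore] -/
theorem hasDerivAt_vel_apply {γ : ℝ → Kerr.exterior M a}
    (hγ : IsGeodesic (Kerr.smoothMetric M a (Kerr.rPlus M a)).leviCivita γ) (s : ℝ) (κ : Fin 4) :
    HasDerivAt (fun t ↦ vel γ t κ) (-christoffelVec M a (γ s) (vel γ s) (vel γ s) κ) s :=
  (EuclideanSpace.proj (𝕜 := ℝ) κ).hasFDerivAt.comp_hasDerivAt s (hasDerivAt_vel hγ s)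

/-- The metric components along the curve, `t ↦ g_{γ t}(u, w)`, have derivative
`(∂_{γ̇} g)(u, w)`. [folklore] -/
theorem hasDerivAt_bilin_comp {γ : ℝ → Kerr.exterior M a}
    (hγ : IsGeodesic (Kerr.smoothMetric M a (Kerr.rPlus M a)).leviCivita γ) (s : ℝ) (u w : E4) :
    HasDerivAt (fun t ↦ Kerr.bilin M a (γ t) u w)
      (fderiv ℝ (Kerr.bilin M a) (γ s) (vel γ s) u w) s := by
  have hdiff : DifferentiableAt ℝ (Kerr.bilin M a) (γ s) := Kerr.differentiableAt_bilin M a (γ s)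
  have h := (OpensChart.differentiableAt_apply₂ (Kerr.bilin M a) hdiff u w).hasFDerivAt.comp_hasDerivAt
    s (hasDerivAt_pos hγ s)
  rw [OpensChart.fderiv_apply₂ (Kerr.bilin M a) hdiff] at h
  exact h

/-- **`ṗ_μ = ½ ∂_μ g(γ̇, γ̇)` along a geodesic** (the geodesic equations in the momentum
variable: `ṗ_μ = (∂_{γ̇} g)(γ̇, ∂_μ) + g(γ̈, ∂_μ)` with `γ̈ = −Γ(γ̇, γ̇)` and
`g(Γ(γ̇, γ̇), ∂_μ) = ½ K(γ̇, γ̇, ∂_μ)`; O'Neill 1983, Ch. 3, Prop. 13 and Cor. 21). With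
`∂_μ g(γ̇, γ̇) = −∂_μ g⁻¹(p, p)` (`fderiv_bilin_vel_vel_eq`) this is Hamilton's second equation
`ṗ = −∂H/∂x` for `H = ½ g⁻¹(p, p)` (Sbierski, arXiv:1311.2477, §2.2, p. 12).
[cite: Sbierski2015, §3 (arXiv §2.2, p. 12)] -/
theorem hasDerivAt_momentum {γ : ℝ → Kerr.exterior M a}
    (hγ : IsGeodesic (Kerr.smoothMetric M a (Kerr.rPlus M a)).leviCivita γ) (s : ℝ) (μ : Fin 4) :
    HasDerivAt (fun t ↦ momentum M a γ t μ)
      (2⁻¹ * fderiv ℝ (Kerr.bilin M a) (γ s) (E4.basisVector μ) (vel γ s) (vel γ s)) s := by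
  have hx := Kerr.radius_pos_of_mem_region (γ s).2
  have hdiff : DifferentiableAt ℝ (Kerr.bilin M a) (γ s) := Kerr.differentiableAt_bilin M a (γ s)
  set x : E4 := (γ s : E4) with hx_def
  set v : E4 := vel γ s with hv_def
  set Γv : E4 := christoffelVec M a x v v with hΓ
  -- `p_μ(t) = ∑_κ γ̇^κ(t) g_{γ t}(∂_κ, ∂_μ)`
  have hfun : (fun t ↦ momentum M a γ t μ) = fun t ↦
      ∑ κ, vel γ t κ * Kerr.bilin M a (γ t) (E4.basisVector κ) (E4.basisVector μ) := by
    funext t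
    exact Kerr.bilin_eq_sum_apply M a (γ t) (vel γ t) (E4.basisVector μ)
  rw [hfun]
  have hsum : HasDerivAt
      (fun t ↦ ∑ κ, vel γ t κ * Kerr.bilin M a (γ t) (E4.basisVector κ) (E4.basisVector μ))
      (∑ κ, (-Γv κ * Kerr.bilin M a x (E4.basisVector κ) (E4.basisVector μ) +
        v κ * fderiv ℝ (Kerr.bilin M a) x v (E4.basisVector κ) (E4.basisVector μ))) s := by
    refine HasDerivAt.fun_sum fun κ _ ↦ ?_
    have h := (hasDerivAt_vel_apply hγ s κ).mul (hasDerivAt_bilin_comp hγ s (E4.basisVector κ)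
      (E4.basisVector μ))
    refine h.congr_deriv ?_
    simp only [hΓ, hx_def, hv_def]
  refine hsum.congr_deriv ?_
  -- `∑_κ Γ^κ g(∂_κ, ∂_μ) = g(Γ, ∂_μ) = ½ K(v, v, ∂_μ)` and `∑_κ v^κ ∂_v g(∂_κ, ∂_μ) = ∂_v g(v, ∂_μ)`
  have h1 : ∑ κ, Γv κ * Kerr.bilin M a x (E4.basisVector κ) (E4.basisVector μ) =
      koszulHalf M a x v v (E4.basisVector μ) := by
    rw [← Kerr.bilin_eq_sum_apply, hΓ, bilin_christoffelVec hx]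
  have h2 : ∑ κ, v κ * fderiv ℝ (Kerr.bilin M a) x v (E4.basisVector κ) (E4.basisVector μ) =
      fderiv ℝ (Kerr.bilin M a) x v v (E4.basisVector μ) := by
    rw [← ContinuousLinearMap.flip_apply (fderiv ℝ (Kerr.bilin M a) x v),
      clm_apply_eq_sum ((fderiv ℝ (Kerr.bilin M a) x v).flip (E4.basisVector μ)) v]
    simp only [ContinuousLinearMap.flip_apply]
  rw [Finset.sum_add_distrib, h2, show (∑ κ, -Γv κ * Kerr.bilin M a x (E4.basisVector κ)
      (E4.basisVector μ)) = -koszulHalf M a x v v (E4.basisVector μ) by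
    rw [← h1, ← Finset.sum_neg_distrib]; exact Finset.sum_congr rfl fun κ _ ↦ by ring]
  unfold koszulHalf
  rw [Kerr.fderiv_bilin_symm M a hdiff v (E4.basisVector μ) v]
  ring

variable (M a) in
/-- The derivatives of the components of the inverse Kerr metric in the coordinate directions,
`∂_κ g^{μν}(x)` (the entries of Sbierski's `B` before contraction with `p`, arXiv:1311.2477,
§2.2, (2.18)). [cite: Sbierski2015, §3 (arXiv §2.2, (2.18))] -/
def dInv (x : E4) (κ μ ν : Fin 4) : ℝ :=
  fderiv ℝ (fun y ↦ Kerr.inverseMetric M a y μ ν) x (E4.basisVector κ)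

variable (M a) in
/-- **`−∂H/∂x^κ`** at the point `x` with momentum `p`, `H = ½ g^{μν}(x) p_μ p_ν`:
`−½ ∑_{μν} ∂_κ g^{μν} p_μ p_ν`, the right-hand side of Hamilton's equation for `ṗ_κ`
(Sbierski, arXiv:1311.2477, §2.2, p. 12). [cite: Sbierski2015, §3 (arXiv §2.2, p. 12)] -/
def momentumRHS (x : E4) (p : Fin 4 → ℝ) (κ : Fin 4) : ℝ :=
  -(2⁻¹ * ∑ μ, ∑ ν, dInv M a x κ μ ν * p μ * p ν)

/-- **Hamilton's second equation `ṗ_κ = −∂H/∂x^κ` along a geodesic of the Kerr exterior**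
(`hasDerivAt_momentum` with `fderiv_bilin_vel_vel_eq`). Sbierski, arXiv:1311.2477, §2.2, p. 12:
"`γ` is a null geodesic, thus it satisfies the equations of the geodesic flow on `T*M`".
[cite: Sbierski2015, §3 (arXiv §2.2, p. 12)] -/
theorem hasDerivAt_momentum' {γ : ℝ → Kerr.exterior M a}
    (hγ : IsGeodesic (Kerr.smoothMetric M a (Kerr.rPlus M a)).leviCivita γ) (s : ℝ) (κ : Fin 4) :
    HasDerivAt (fun t ↦ momentum M a γ t κ) (momentumRHS M a (γ s) (momentum M a γ s) κ) s := by
  refine (hasDerivAt_momentum hγ s κ).congr_deriv ?_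
  rw [fderiv_bilin_vel_vel_eq γ s κ, momentumRHS]
  simp only [dInv]
  ring

omit [Kerr.SliceFacts] in
/-- **Null velocity in momentum form**: `∑_μ γ̇^μ p_μ = g(γ̇, γ̇) = 0` along a null curve.
[cite: Sbierski2015, §3 (arXiv §2.2, (2.14))] -/
theorem sum_vel_mul_momentum {γ : ℝ → Kerr.exterior M a} {s : ℝ}
    (hnull : (Kerr.smoothMetric M a (Kerr.rPlus M a)).IsNull (velocity 𝓘(ℝ, E4) γ s)) :
    ∑ μ, vel γ s μ * momentum M a γ s μ = 0 := by
  rw [← bilin_vel_eq_sum γ s (vel γ s)]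
  exact hnull.1

omit [Kerr.SliceFacts] in
/-- A null velocity is a nonzero vector. [cite: ONeill1983, Ch. 3, p. 56] -/
theorem vel_ne_zero {γ : ℝ → Kerr.exterior M a} {s : ℝ}
    (hnull : (Kerr.smoothMetric M a (Kerr.rPlus M a)).IsNull (velocity 𝓘(ℝ, E4) γ s)) :
    vel γ s ≠ 0 :=
  hnull.2

end Hamilton

/-! ### Derivatives of the inverse metric and the Jacobi data `A`, `B`, `C` -/

section JacobiData

variable {M a : ℝ}

variable (M a) in
/-- The second derivatives of the components of the inverse Kerr metric,
`∂_l ∂_κ g^{μν}(x)`, as derivatives of the scalar functions `∂_κ g^{μν}` (the entries of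
Sbierski's `A` before contraction with `p ⊗ p`, arXiv:1311.2477, §2.2, (2.17)).
[cite: Sbierski2015, §3 (arXiv §2.2, (2.17))] -/
def ddInv (x : E4) (κ l μ ν : Fin 4) : ℝ :=
  fderiv ℝ (fun y ↦ dInv M a y κ μ ν) x (E4.basisVector l)

/-- `∂_κ g^{μν} = ∂_κ g^{νμ}`. [folklore] -/
theorem dInv_symm (x : E4) (κ μ ν : Fin 4) : dInv M a x κ μ ν = dInv M a x κ ν μ := by
  unfold dInv
  rw [show (fun y ↦ Kerr.inverseMetric M a y μ ν) = fun y ↦ Kerr.inverseMetric M a y ν μ from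
    funext fun y ↦ Kerr.inverseMetric_symm M a y μ ν]

/-- `∂_l ∂_κ g^{μν} = ∂_l ∂_κ g^{νμ}`. [folklore] -/
theorem ddInv_symm_right (x : E4) (κ l μ ν : Fin 4) :
    ddInv M a x κ l μ ν = ddInv M a x κ l ν μ := by
  unfold ddInv
  rw [show (fun y ↦ dInv M a y κ μ ν) = fun y ↦ dInv M a y κ ν μ from
    funext fun y ↦ dInv_symm y κ μ ν]

/-- `∂_κ g^{μν}` is `C^n` on `{r > 0}`. [cite: KerrSchild1965, §3] -/
theorem contDiffAt_dInv {x : E4} (hx : 0 < Kerr.radius a x) (κ μ ν : Fin 4) {n : WithTop ℕ∞} :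
    ContDiffAt ℝ n (fun y ↦ dInv M a y κ μ ν) x := by
  unfold dInv
  exact ((Kerr.contDiffAt_inverseMetric M a hx μ ν (n := n + 1)).fderiv_right le_rfl).clm_apply
    contDiffAt_const

/-- `∂_l ∂_κ g^{μν}` is `C^n` on `{r > 0}`. [cite: KerrSchild1965, §3] -/
theorem contDiffAt_ddInv {x : E4} (hx : 0 < Kerr.radius a x) (κ l μ ν : Fin 4)
    {n : WithTop ℕ∞} : ContDiffAt ℝ n (fun y ↦ ddInv M a y κ l μ ν) x := by
  unfold ddInv
  exact ((contDiffAt_dInv hx κ μ ν (n := n + 1)).fderiv_right le_rfl).clm_apply contDiffAt_const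

/-- Directional derivative of `g^{μν}` in terms of `dInv`: `∂_w g^{μν} = ∑_κ w^κ ∂_κ g^{μν}`.
[folklore] -/
theorem fderiv_inverseMetric_apply (x w : E4) (μ ν : Fin 4) :
    fderiv ℝ (fun y ↦ Kerr.inverseMetric M a y μ ν) x w = ∑ κ, w κ * dInv M a x κ μ ν := by
  unfold dInv
  exact clm_apply_eq_sum _ w

/-- Directional derivative of `∂_κ g^{μν}` in terms of `ddInv`:
`∂_w ∂_κ g^{μν} = ∑_l w^l ∂_l ∂_κ g^{μν}`. [folklore] -/
theorem fderiv_dInv_apply (x w : E4) (κ μ ν : Fin 4) :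
    fderiv ℝ (fun y ↦ dInv M a y κ μ ν) x w = ∑ l, w l * ddInv M a x κ l μ ν := by
  unfold ddInv
  exact clm_apply_eq_sum _ w

/-- **Symmetry of the second derivatives**: `∂_l ∂_κ g^{μν} = ∂_κ ∂_l g^{μν}` on `{r > 0}`
(Schwarz; Mathlib's `ContDiffAt.isSymmSndFDerivAt`). This is the symmetry of Sbierski's `A`.
[folklore] -/
theorem ddInv_symm {x : E4} (hx : 0 < Kerr.radius a x) (κ l μ ν : Fin 4) :
    ddInv M a x κ l μ ν = ddInv M a x l κ μ ν := by
  set f : E4 → ℝ := fun y ↦ Kerr.inverseMetric M a y μ ν with hf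
  have hf2 : ContDiffAt ℝ 2 f x := Kerr.contDiffAt_inverseMetric M a hx μ ν
  have hff : HasFDerivAt (fderiv ℝ f) (fderiv ℝ (fderiv ℝ f) x) x :=
    ((hf2.fderiv_right (m := 1) le_rfl).differentiableAt one_ne_zero).hasFDerivAt
  -- `dInv` is `apply ∘ fderiv f`
  have hrepr : ∀ ρ, (fun y ↦ dInv M a y ρ μ ν) =
      ⇑(ContinuousLinearMap.apply ℝ ℝ (E4.basisVector ρ)) ∘ fderiv ℝ f := fun ρ ↦ rfl
  have hchain : ∀ ρ σ, ddInv M a x ρ σ μ ν =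
      fderiv ℝ (fderiv ℝ f) x (E4.basisVector σ) (E4.basisVector ρ) := by
    intro ρ σ
    unfold ddInv
    rw [hrepr ρ, ((ContinuousLinearMap.apply ℝ ℝ (E4.basisVector ρ)).hasFDerivAt.comp x hff).fderiv]
    rfl
  have hsym := hf2.isSymmSndFDerivAt (by simp)
  rw [hchain, hchain, hsym]

variable (M a) in
/-- **Sbierski's `A`** along a point `(x, p)` of the cotangent bundle:
`A_{κl} = ∂²H/∂x^κ∂x^l = ½ ∑_{μν} ∂_l∂_κ g^{μν} p_μ p_ν`, `H = ½ g^{μν} p_μ p_ν`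
(arXiv:1311.2477, §2.2, (2.17)). [cite: Sbierski2015, §3 (arXiv §2.2, (2.17))] -/
def jacobiA (x : E4) (p : Fin 4 → ℝ) : Matrix (Fin 4) (Fin 4) ℝ :=
  Matrix.of fun κ l ↦ 2⁻¹ * ∑ μ, ∑ ν, ddInv M a x κ l μ ν * p μ * p ν

variable (M a) in
/-- **Sbierski's `B`**: `B_{κρ} = ∂²H/∂x^κ∂p_ρ = ∑_ν ∂_κ g^{ρν} p_ν`
(arXiv:1311.2477, §2.2, (2.18)). [cite: Sbierski2015, §3 (arXiv §2.2, (2.18))] -/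
def jacobiB (x : E4) (p : Fin 4 → ℝ) : Matrix (Fin 4) (Fin 4) ℝ :=
  Matrix.of fun κ ρ ↦ ∑ ν, dInv M a x κ ρ ν * p ν

variable (M a) in
/-- **Sbierski's `C`**: `C_{κρ} = ∂²H/∂p_κ∂p_ρ = g^{κρ}` (arXiv:1311.2477, §2.2, (2.19)).
[cite: Sbierski2015, §3 (arXiv §2.2, (2.19))] -/
def jacobiC (x : E4) : Matrix (Fin 4) (Fin 4) ℝ :=
  Matrix.of fun κ ρ ↦ Kerr.inverseMetric M a x κ ρ

/-- Entries of `A`. [folklore] -/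
theorem jacobiA_apply (x : E4) (p : Fin 4 → ℝ) (κ l : Fin 4) :
    jacobiA M a x p κ l = 2⁻¹ * ∑ μ, ∑ ν, ddInv M a x κ l μ ν * p μ * p ν := rfl

/-- Entries of `B`. [folklore] -/
theorem jacobiB_apply (x : E4) (p : Fin 4 → ℝ) (κ ρ : Fin 4) :
    jacobiB M a x p κ ρ = ∑ ν, dInv M a x κ ρ ν * p ν := rfl

/-- Entries of `C`. [folklore] -/
theorem jacobiC_apply (x : E4) (κ ρ : Fin 4) : jacobiC M a x κ ρ = Kerr.inverseMetric M a x κ ρ :=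
  rfl

/-- `A` is symmetric (Schwarz). [cite: Sbierski2015, §3 (arXiv §2.2, (2.17))] -/
theorem jacobiA_transpose {x : E4} (hx : 0 < Kerr.radius a x) (p : Fin 4 → ℝ) :
    (jacobiA M a x p)ᵀ = jacobiA M a x p := by
  ext κ l
  rw [Matrix.transpose_apply, jacobiA_apply, jacobiA_apply]
  congr 1
  exact Finset.sum_congr rfl fun μ _ ↦ Finset.sum_congr rfl fun ν _ ↦ by rw [ddInv_symm hx]

/-- `C` is symmetric. [cite: Sbierski2015, §3 (arXiv §2.2, (2.19))] -/
theorem jacobiC_transpose (x : E4) : (jacobiC M a x)ᵀ = jacobiC M a x := by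
  ext κ ρ
  rw [Matrix.transpose_apply, jacobiC_apply, jacobiC_apply, Kerr.inverseMetric_symm]

end JacobiData

/-! ### The tangent of the lift `(γ, γ̇♭)` solves the linearised Hamiltonian (Jacobi) system -/

section Jacobi

variable [Kerr.Facts] [Kerr.SliceFacts] {M a : ℝ}

/-- The inverse metric along the curve has derivative `∑_κ γ̇^κ ∂_κ g^{μν}`. [folklore] -/
theorem hasDerivAt_inverseMetric_comp {γ : ℝ → Kerr.exterior M a}
    (hγ : IsGeodesic (Kerr.smoothMetric M a (Kerr.rPlus M a)).leviCivita γ) (s : ℝ) (μ ν : Fin 4) :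
    HasDerivAt (fun t ↦ Kerr.inverseMetric M a (γ t) μ ν)
      (∑ κ, vel γ s κ * dInv M a (γ s) κ μ ν) s := by
  have hx := Kerr.radius_pos_of_mem_region (γ s).2
  have hd : DifferentiableAt ℝ (fun y ↦ Kerr.inverseMetric M a y μ ν) (γ s) :=
    (Kerr.contDiffAt_inverseMetric M a hx μ ν (n := 1)).differentiableAt one_ne_zero
  have h := hd.hasFDerivAt.comp_hasDerivAt s (hasDerivAt_pos hγ s)
  rw [fderiv_inverseMetric_apply] at h
  exact h

/-- `∂_κ g^{μν}` along the curve has derivative `∑_l γ̇^l ∂_l ∂_κ g^{μν}`. [folklore] -/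
theorem hasDerivAt_dInv_comp {γ : ℝ → Kerr.exterior M a}
    (hγ : IsGeodesic (Kerr.smoothMetric M a (Kerr.rPlus M a)).leviCivita γ) (s : ℝ)
    (κ μ ν : Fin 4) :
    HasDerivAt (fun t ↦ dInv M a (γ t) κ μ ν) (∑ l, vel γ s l * ddInv M a (γ s) κ l μ ν) s := by
  have hx := Kerr.radius_pos_of_mem_region (γ s).2
  have hd : DifferentiableAt ℝ (fun y ↦ dInv M a y κ μ ν) (γ s) :=
    (contDiffAt_dInv hx κ μ ν (n := 1)).differentiableAt one_ne_zero
  have h := hd.hasFDerivAt.comp_hasDerivAt s (hasDerivAt_pos hγ s)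
  rw [fderiv_dInv_apply] at h
  exact h

/-- **The velocity solves `ẋ = Bᵀ x + C ξ`** with `ξ = ṗ`: differentiating `γ̇^ρ = g^{ρν} p_ν`
(`vel_eq_sum`) along the geodesic gives `γ̈^ρ = ∑_κ B_{κρ} γ̇^κ + ∑_ν C_{ρν} ṗ_ν`, `ṗ = −∂H/∂x`
(Sbierski, arXiv:1311.2477, §2.2, p. 13: "`s ↦ σ̇(s)` is a solution of (2.20)", `x`-components).
[cite: Sbierski2015, §3 (arXiv §2.2, (2.26))] -/
theorem hasDerivAt_vel_jacobi {γ : ℝ → Kerr.exterior M a}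
    (hγ : IsGeodesic (Kerr.smoothMetric M a (Kerr.rPlus M a)).leviCivita γ) (s : ℝ) (ρ : Fin 4) :
    HasDerivAt (fun t ↦ vel γ t ρ)
      (∑ κ, jacobiB M a (γ s) (momentum M a γ s) κ ρ * vel γ s κ +
        ∑ ν, jacobiC M a (γ s) ρ ν * momentumRHS M a (γ s) (momentum M a γ s) ν) s := by
  have hfun : (fun t ↦ vel γ t ρ) =
      fun t ↦ ∑ ν, Kerr.inverseMetric M a (γ t) ρ ν * momentum M a γ t ν :=
    funext fun t ↦ vel_eq_sum γ t ρ
  rw [hfun]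
  have hsum := HasDerivAt.fun_sum (u := Finset.univ) fun ν _ ↦
    (hasDerivAt_inverseMetric_comp hγ s ρ ν).mul (hasDerivAt_momentum' hγ s ν)
  refine hsum.congr_deriv ?_
  rw [Finset.sum_add_distrib]
  congr 1
  simp only [jacobiB_apply, Finset.sum_mul]
  rw [Finset.sum_comm]
  exact Finset.sum_congr rfl fun κ _ ↦ Finset.sum_congr rfl fun ν _ ↦ by ring

/-- **The momentum derivative solves `ξ̇ = −A x − B ξ`**: differentiating Hamilton's equation
`ṗ_κ = −½ ∑ ∂_κ g^{μν} p_μ p_ν` along the geodesic gives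
`p̈_κ = −∑_l A_{κl} γ̇^l − ∑_ρ B_{κρ} ṗ_ρ` (Sbierski, arXiv:1311.2477, §2.2, p. 13: "`s ↦ σ̇(s)` is a
solution of (2.20)", `p`-components). [cite: Sbierski2015, §3 (arXiv §2.2, (2.26))] -/
theorem hasDerivAt_momentumRHS {γ : ℝ → Kerr.exterior M a}
    (hγ : IsGeodesic (Kerr.smoothMetric M a (Kerr.rPlus M a)).leviCivita γ) (s : ℝ) (κ : Fin 4) :
    HasDerivAt (fun t ↦ momentumRHS M a (γ t) (momentum M a γ t) κ)
      (-(∑ l, jacobiA M a (γ s) (momentum M a γ s) κ l * vel γ s l) -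
        ∑ ρ, jacobiB M a (γ s) (momentum M a γ s) κ ρ *
          momentumRHS M a (γ s) (momentum M a γ s) ρ) s := by
  set x : E4 := (γ s : E4) with hx_def
  set v : E4 := vel γ s with hv_def
  set p : Fin 4 → ℝ := momentum M a γ s with hp_def
  set pd : Fin 4 → ℝ := momentumRHS M a x p with hpd_def
  -- derivative of each summand `∂_κ g^{μν} p_μ p_ν`
  have hterm : ∀ μ ν, HasDerivAt (fun t ↦ dInv M a (γ t) κ μ ν * momentum M a γ t μ *
      momentum M a γ t ν)
      ((∑ l, v l * ddInv M a x κ l μ ν) * p μ * p ν + dInv M a x κ μ ν * pd μ * p ν +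
        dInv M a x κ μ ν * p μ * pd ν) s := by
    intro μ ν
    have h := ((hasDerivAt_dInv_comp hγ s κ μ ν).mul (hasDerivAt_momentum' hγ s μ)).mul
      (hasDerivAt_momentum' hγ s ν)
    refine h.congr_deriv ?_
    simp only [hx_def, hv_def, hp_def, hpd_def, Pi.mul_apply]
    ring
  have hsum : HasDerivAt (fun t ↦ momentumRHS M a (γ t) (momentum M a γ t) κ)
      (-(2⁻¹ * ∑ μ, ∑ ν, ((∑ l, v l * ddInv M a x κ l μ ν) * p μ * p ν +
        dInv M a x κ μ ν * pd μ * p ν + dInv M a x κ μ ν * p μ * pd ν))) s := by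
    unfold momentumRHS
    exact ((HasDerivAt.fun_sum (u := Finset.univ) fun μ _ ↦
      HasDerivAt.fun_sum (u := Finset.univ) fun ν _ ↦ hterm μ ν).const_mul 2⁻¹).neg
  refine hsum.congr_deriv ?_
  -- bookkeeping: the `A` term
  have hA : ∑ μ, ∑ ν, (∑ l, v l * ddInv M a x κ l μ ν) * p μ * p ν =
      2 * ∑ l, jacobiA M a x p κ l * v l := by
    simp only [jacobiA_apply, Finset.sum_mul, Finset.mul_sum]
    rw [Finset.sum_congr rfl fun μ _ ↦ Finset.sum_comm, Finset.sum_comm]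
    exact Finset.sum_congr rfl fun l _ ↦ Finset.sum_congr rfl fun μ _ ↦
      Finset.sum_congr rfl fun ν _ ↦ by ring
  -- the two `B` terms are equal by the symmetry of `∂_κ g^{μν}` in `μν`
  have hB1 : ∑ μ, ∑ ν, dInv M a x κ μ ν * pd μ * p ν = ∑ ρ, jacobiB M a x p κ ρ * pd ρ := by
    simp only [jacobiB_apply, Finset.sum_mul]
    exact Finset.sum_congr rfl fun μ _ ↦ Finset.sum_congr rfl fun ν _ ↦ by ring
  have hB2 : ∑ μ, ∑ ν, dInv M a x κ μ ν * p μ * pd ν = ∑ ρ, jacobiB M a x p κ ρ * pd ρ := by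
    simp only [jacobiB_apply, Finset.sum_mul]
    rw [Finset.sum_comm]
    exact Finset.sum_congr rfl fun ν _ ↦ Finset.sum_congr rfl fun μ _ ↦ by
      rw [dInv_symm x κ μ ν]
  simp only [Finset.sum_add_distrib]
  rw [hA, hB1, hB2]
  ring

end Jacobi

/-! ### Smoothness of the momentum and of the Jacobi data along the geodesic -/

section Smooth

variable [Kerr.Facts] [Kerr.SliceFacts] {M a : ℝ}

omit [Kerr.Facts] [Kerr.SliceFacts] in
/-- The metric components `y ↦ g_y(u, w)` are `C^n` on `{r > 0}`. [cite: KerrSchild1965, §3] -/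
theorem contDiffAt_bilin_apply₂ {x : E4} (hx : 0 < Kerr.radius a x) (u w : E4)
    {n : WithTop ℕ∞} : ContDiffAt ℝ n (fun y ↦ Kerr.bilin M a y u w) x :=
  ((Kerr.contDiffAt_bilin M a hx).clm_apply contDiffAt_const).clm_apply contDiffAt_const

/-- A function of the point, smooth on `{r > 0}`, is smooth along a geodesic of the exterior.
[folklore] -/
theorem contDiff_comp_pos {γ : ℝ → Kerr.exterior M a}
    (hγ : IsGeodesic (Kerr.smoothMetric M a (Kerr.rPlus M a)).leviCivita γ) {g : E4 → ℝ}
    (hg : ∀ x : E4, 0 < Kerr.radius a x → ContDiffAt ℝ ∞ g x) :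
    ContDiff ℝ ∞ (fun t ↦ g (γ t)) :=
  contDiff_iff_contDiffAt.2 fun t ↦
    (hg _ (Kerr.radius_pos_of_mem_region (γ t).2)).comp t (contDiff_pos hγ).contDiffAt

/-- `t ↦ g_{γ t}(u, w)` is smooth along a geodesic. [folklore] -/
theorem contDiff_bilin_comp {γ : ℝ → Kerr.exterior M a}
    (hγ : IsGeodesic (Kerr.smoothMetric M a (Kerr.rPlus M a)).leviCivita γ) (u w : E4) :
    ContDiff ℝ ∞ (fun t ↦ Kerr.bilin M a (γ t) u w) :=
  contDiff_comp_pos hγ (g := fun y ↦ Kerr.bilin M a y u w) fun _ hx ↦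
    contDiffAt_bilin_apply₂ hx u w

/-- The components of the velocity are smooth. [folklore] -/
theorem contDiff_vel_apply {γ : ℝ → Kerr.exterior M a}
    (hγ : IsGeodesic (Kerr.smoothMetric M a (Kerr.rPlus M a)).leviCivita γ) (κ : Fin 4) :
    ContDiff ℝ ∞ (fun t ↦ vel γ t κ) :=
  contDiff_euclidean.1 (contDiff_vel hγ) κ

/-- **The momentum of a geodesic is smooth.** [folklore] -/
theorem contDiff_momentum {γ : ℝ → Kerr.exterior M a}
    (hγ : IsGeodesic (Kerr.smoothMetric M a (Kerr.rPlus M a)).leviCivita γ) (μ : Fin 4) :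
    ContDiff ℝ ∞ (fun t ↦ momentum M a γ t μ) := by
  have hfun : (fun t ↦ momentum M a γ t μ) = fun t ↦
      ∑ κ, vel γ t κ * Kerr.bilin M a (γ t) (E4.basisVector κ) (E4.basisVector μ) := by
    funext t
    exact Kerr.bilin_eq_sum_apply M a (γ t) (vel γ t) (E4.basisVector μ)
  rw [hfun]
  exact ContDiff.sum fun κ _ ↦ (contDiff_vel_apply hγ κ).mul (contDiff_bilin_comp hγ _ _)

/-- The inverse metric is smooth along a geodesic. [folklore] -/
theorem contDiff_inverseMetric_comp {γ : ℝ → Kerr.exterior M a}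
    (hγ : IsGeodesic (Kerr.smoothMetric M a (Kerr.rPlus M a)).leviCivita γ) (μ ν : Fin 4) :
    ContDiff ℝ ∞ (fun t ↦ Kerr.inverseMetric M a (γ t) μ ν) :=
  contDiff_comp_pos hγ (g := fun y ↦ Kerr.inverseMetric M a y μ ν) fun _ hx ↦
    Kerr.contDiffAt_inverseMetric M a hx μ ν

/-- `∂_κ g^{μν}` is smooth along a geodesic. [folklore] -/
theorem contDiff_dInv_comp {γ : ℝ → Kerr.exterior M a}
    (hγ : IsGeodesic (Kerr.smoothMetric M a (Kerr.rPlus M a)).leviCivita γ) (κ μ ν : Fin 4) :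
    ContDiff ℝ ∞ (fun t ↦ dInv M a (γ t) κ μ ν) :=
  contDiff_comp_pos hγ (g := fun y ↦ dInv M a y κ μ ν) fun _ hx ↦ contDiffAt_dInv hx κ μ ν

/-- `∂_l ∂_κ g^{μν}` is smooth along a geodesic. [folklore] -/
theorem contDiff_ddInv_comp {γ : ℝ → Kerr.exterior M a}
    (hγ : IsGeodesic (Kerr.smoothMetric M a (Kerr.rPlus M a)).leviCivita γ) (κ l μ ν : Fin 4) :
    ContDiff ℝ ∞ (fun t ↦ ddInv M a (γ t) κ l μ ν) :=
  contDiff_comp_pos hγ (g := fun y ↦ ddInv M a y κ l μ ν) fun _ hx ↦ contDiffAt_ddInv hx κ l μ ν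

/-- `ṗ = −∂H/∂x` is smooth along a geodesic. [folklore] -/
theorem contDiff_momentumRHS {γ : ℝ → Kerr.exterior M a}
    (hγ : IsGeodesic (Kerr.smoothMetric M a (Kerr.rPlus M a)).leviCivita γ) (κ : Fin 4) :
    ContDiff ℝ ∞ (fun t ↦ momentumRHS M a (γ t) (momentum M a γ t) κ) := by
  unfold momentumRHS
  exact (contDiff_const.mul (ContDiff.sum fun μ _ ↦ ContDiff.sum fun ν _ ↦
    ((contDiff_dInv_comp hγ κ μ ν).mul (contDiff_momentum hγ μ)).mul
      (contDiff_momentum hγ ν))).neg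

/-- The entries of `A` are smooth along a geodesic. [cite: Sbierski2015, §3 (arXiv §2.2, (2.17))] -/
theorem contDiff_jacobiA {γ : ℝ → Kerr.exterior M a}
    (hγ : IsGeodesic (Kerr.smoothMetric M a (Kerr.rPlus M a)).leviCivita γ) (κ l : Fin 4) :
    ContDiff ℝ ∞ (fun t ↦ jacobiA M a (γ t) (momentum M a γ t) κ l) := by
  simp only [jacobiA_apply]
  exact contDiff_const.mul (ContDiff.sum fun μ _ ↦ ContDiff.sum fun ν _ ↦
    ((contDiff_ddInv_comp hγ κ l μ ν).mul (contDiff_momentum hγ μ)).mul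
      (contDiff_momentum hγ ν))

/-- The entries of `B` are smooth along a geodesic. [cite: Sbierski2015, §3 (arXiv §2.2, (2.18))] -/
theorem contDiff_jacobiB {γ : ℝ → Kerr.exterior M a}
    (hγ : IsGeodesic (Kerr.smoothMetric M a (Kerr.rPlus M a)).leviCivita γ) (κ ρ : Fin 4) :
    ContDiff ℝ ∞ (fun t ↦ jacobiB M a (γ t) (momentum M a γ t) κ ρ) := by
  simp only [jacobiB_apply]
  exact ContDiff.sum fun ν _ ↦ (contDiff_dInv_comp hγ κ ρ ν).mul (contDiff_momentum hγ ν)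

/-- The entries of `C` are smooth along a geodesic. [cite: Sbierski2015, §3 (arXiv §2.2, (2.19))] -/
theorem contDiff_jacobiC {γ : ℝ → Kerr.exterior M a}
    (hγ : IsGeodesic (Kerr.smoothMetric M a (Kerr.rPlus M a)).leviCivita γ) (κ ρ : Fin 4) :
    ContDiff ℝ ∞ (fun t ↦ jacobiC M a (γ t) κ ρ) := by
  simp only [jacobiC_apply]
  exact contDiff_inverseMetric_comp hγ κ ρ

end Smooth

/-! ### The initial Hessian `M(0)`: symmetric, compatible, with imaginary part of kernel `ℂ γ̇(0)` -/

section InitialHessian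

open Literature.Analysis.ODE.GaussianBeamRiccati

variable (x₀ ξ₀ : Fin 4 → ℝ)

/-- Rows of the **shear matrix** `L : ℝ⁴ → ℝ³`, `(L f)_i = f_{i+1} − (x₀^{i+1}/x₀⁰) f_0`, whose
kernel is the line `ℝ x₀` (for `x₀⁰ ≠ 0`); `Im M(0) := LᵀL` is then positive semi-definite with
kernel exactly `ℂ x₀`, which is Sbierski's requirement iii) on `M(0)` (arXiv:1311.2477, §2.2, p. 13:
"`Im(M(0))` is positive definite on a three dimensional subspace transversal to `γ̇`").
[cite: Sbierski2015, §3 (arXiv §2.2, p. 13, iii))] -/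
def shearRow (i : Fin 3) (μ : Fin 4) : ℝ :=
  (if μ = i.succ then 1 else 0) - x₀ i.succ / x₀ 0 * (if μ = 0 then 1 else 0)

/-- The imaginary part `Im M(0) = LᵀL` of the initial Hessian. [cite: Sbierski2015, §3 (arXiv §2.2, p. 13, iii))] -/
def imPart (μ ν : Fin 4) : ℝ := ∑ i : Fin 3, shearRow x₀ i μ * shearRow x₀ i ν

/-- The real part of the initial Hessian: a real symmetric matrix `R` with `R x₀ = ξ₀`, namely
`R = (ξ₀ ⊗ e⁰ + e⁰ ⊗ ξ₀)/x₀⁰ − ((ξ₀·x₀)/(x₀⁰)²) e⁰ ⊗ e⁰`; this realises Sbierski's requirement ii)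
`M(0) γ̇(0) = (dφ)˙(0)` (arXiv:1311.2477, §2.2, p. 13) since the imaginary part kills `x₀`.
[cite: Sbierski2015, §3 (arXiv §2.2, p. 13, ii))] -/
def rePart (μ ν : Fin 4) : ℝ :=
  (ξ₀ μ * (if ν = 0 then 1 else 0) + (if μ = 0 then 1 else 0) * ξ₀ ν) / x₀ 0 -
    (∑ k, ξ₀ k * x₀ k) / x₀ 0 ^ 2 * ((if μ = 0 then 1 else 0) * (if ν = 0 then 1 else 0))

/-- **The initial Hessian `M(0) = R + i LᵀL`** of the phase of a Gaussian beam with initial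
velocity `x₀ = γ̇(0)` (`x₀⁰ > 0`) and `ξ₀ = (dφ)˙(0)`: symmetric, `M(0) x₀ = ξ₀`, `Im M(0) ≥ 0`
with kernel `ℂ x₀` (Sbierski, arXiv:1311.2477, §2.2, p. 13, conditions i)–iii)).
[cite: Sbierski2015, §3 (arXiv §2.2, p. 13)] -/
def initialHessian : Matrix (Fin 4) (Fin 4) ℂ :=
  Matrix.of fun μ ν ↦ (rePart x₀ ξ₀ μ ν : ℂ) + (imPart x₀ μ ν : ℂ) * Complex.I

/-- Entries of the initial Hessian. [folklore] -/
theorem initialHessian_apply (μ ν : Fin 4) :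
    initialHessian x₀ ξ₀ μ ν = (rePart x₀ ξ₀ μ ν : ℂ) + (imPart x₀ μ ν : ℂ) * Complex.I := rfl

/-- `Im M(0)` is symmetric. [folklore] -/
theorem imPart_symm (μ ν : Fin 4) : imPart x₀ μ ν = imPart x₀ ν μ := by
  unfold imPart
  exact Finset.sum_congr rfl fun i _ ↦ mul_comm _ _

/-- `Re M(0)` is symmetric. [folklore] -/
theorem rePart_symm (μ ν : Fin 4) : rePart x₀ ξ₀ μ ν = rePart x₀ ξ₀ ν μ := by
  unfold rePart
  ring

/-- **i) `M(0)` is symmetric.** [cite: Sbierski2015, §3 (arXiv §2.2, p. 13, i))] -/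
theorem initialHessian_transpose : (initialHessian x₀ ξ₀)ᵀ = initialHessian x₀ ξ₀ := by
  ext μ ν
  rw [Matrix.transpose_apply, initialHessian_apply, initialHessian_apply, rePart_symm,
    imPart_symm]

/-- The imaginary parts of the entries of `M(0)`. [folklore] -/
theorem initialHessian_im (μ ν : Fin 4) : (initialHessian x₀ ξ₀ μ ν).im = imPart x₀ μ ν := by
  rw [initialHessian_apply]
  simp

/-- `R x₀ = ξ₀`. [cite: Sbierski2015, §3 (arXiv §2.2, p. 13, ii))] -/
theorem sum_rePart_mul {x₀ : Fin 4 → ℝ} (h0 : x₀ 0 ≠ 0) (ξ₀ : Fin 4 → ℝ) (μ : Fin 4) :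
    ∑ ν, rePart x₀ ξ₀ μ ν * x₀ ν = ξ₀ μ := by
  fin_cases μ
  · simp [rePart, Fin.sum_univ_four]; field_simp; ring
  · simp [rePart, Fin.sum_univ_four]; field_simp
  · simp [rePart, Fin.sum_univ_four]; field_simp
  · simp [rePart, Fin.sum_univ_four]; field_simp

/-- `(LᵀL) x₀ = 0`. [cite: Sbierski2015, §3 (arXiv §2.2, p. 13, iii))] -/
theorem sum_imPart_mul {x₀ : Fin 4 → ℝ} (h0 : x₀ 0 ≠ 0) (μ : Fin 4) :
    ∑ ν, imPart x₀ μ ν * x₀ ν = 0 := by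
  fin_cases μ <;> (simp [imPart, shearRow, Fin.sum_univ_four, Fin.sum_univ_three]; field_simp; ring)

/-- **ii) `M(0) x₀ = ξ₀`** (compatibility of the second with the first derivatives at `s = 0`).
[cite: Sbierski2015, §3 (arXiv §2.2, p. 13, ii))] -/
theorem initialHessian_mulVec {x₀ : Fin 4 → ℝ} (h0 : x₀ 0 ≠ 0) (ξ₀ : Fin 4 → ℝ) :
    initialHessian x₀ ξ₀ *ᵥ (fun μ ↦ (x₀ μ : ℂ)) = fun μ ↦ (ξ₀ μ : ℂ) := by
  funext μ
  simp only [Matrix.mulVec, dotProduct, initialHessian_apply]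
  have h1 := congrArg (fun r : ℝ ↦ (r : ℂ)) (sum_rePart_mul h0 ξ₀ μ)
  have h2 := congrArg (fun r : ℝ ↦ (r : ℂ)) (sum_imPart_mul h0 μ)
  push_cast at h1 h2
  calc ∑ ν, ((rePart x₀ ξ₀ μ ν : ℂ) + (imPart x₀ μ ν : ℂ) * Complex.I) * (x₀ ν : ℂ)
      = ∑ ν, (rePart x₀ ξ₀ μ ν : ℂ) * (x₀ ν : ℂ) +
          (∑ ν, (imPart x₀ μ ν : ℂ) * (x₀ ν : ℂ)) * Complex.I := by
        rw [Finset.sum_mul, ← Finset.sum_add_distrib]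
        exact Finset.sum_congr rfl fun ν _ ↦ by ring
    _ = (ξ₀ μ : ℂ) := by rw [h1, h2, zero_mul, add_zero]

/-- **The Hermitian form of `Im M(0) = LᵀL` is `∑_i |(L f)_i|²`.**
[cite: Sbierski2015, §3 (arXiv §2.2, p. 13, iii))] -/
theorem imForm_initialHessian (f : Fin 4 → ℂ) :
    imForm (initialHessian x₀ ξ₀) f =
      ∑ i : Fin 3, (Complex.normSq (∑ μ, (shearRow x₀ i μ : ℂ) * f μ) : ℂ) := by
  rw [imForm_eq_sum]
  simp_rw [initialHessian_im, imPart]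
  push_cast
  have hconj : ∀ i : Fin 3, (Complex.normSq (∑ μ, (shearRow x₀ i μ : ℂ) * f μ) : ℂ) =
      (∑ μ, (shearRow x₀ i μ : ℂ) * f μ) * ∑ ν, (shearRow x₀ i ν : ℂ) * star (f ν) := by
    intro i
    rw [← Complex.mul_conj, map_sum]
    congr 1
    exact Finset.sum_congr rfl fun ν _ ↦ by rw [map_mul, Complex.conj_ofReal]; rfl
  simp_rw [hconj, Finset.sum_mul, Finset.mul_sum]
  rw [Finset.sum_congr rfl fun (μ : Fin 4) _ ↦ Finset.sum_comm (s := (Finset.univ : Finset (Fin 4)))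
    (t := (Finset.univ : Finset (Fin 3))), Finset.sum_comm]
  exact Finset.sum_congr rfl fun i _ ↦ Finset.sum_congr rfl fun μ _ ↦
    Finset.sum_congr rfl fun ν _ ↦ by ring

/-- `Im M(0) ≥ 0`. [cite: Sbierski2015, §3 (arXiv §2.2, p. 13, iii))] -/
theorem imForm_initialHessian_nonneg (f : Fin 4 → ℂ) :
    0 ≤ (imForm (initialHessian x₀ ξ₀) f).re := by
  rw [imForm_initialHessian, Complex.re_sum]
  exact Finset.sum_nonneg fun i _ ↦ by
    rw [Complex.ofReal_re]
    exact Complex.normSq_nonneg _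

/-- **iii) the kernel of `Im M(0)` is the complex line of `x₀`** (for `x₀⁰ ≠ 0`): if
`∑_i |(L f)_i|² = 0` then `f_{i+1} = (x₀^{i+1}/x₀⁰) f_0` for all `i`, i.e. `f = (f_0/x₀⁰) x₀`.
[cite: Sbierski2015, §3 (arXiv §2.2, p. 13, iii))] -/
theorem eq_smul_of_imForm_initialHessian_eq_zero {x₀ : Fin 4 → ℝ} (h0 : x₀ 0 ≠ 0)
    (ξ₀ : Fin 4 → ℝ) (f : Fin 4 → ℂ) (hf : imForm (initialHessian x₀ ξ₀) f = 0) :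
    ∃ z : ℂ, f = z • fun μ ↦ (x₀ μ : ℂ) := by
  rw [imForm_initialHessian] at hf
  have hre := congrArg Complex.re hf
  rw [Complex.re_sum, Complex.zero_re] at hre
  simp only [Complex.ofReal_re] at hre
  have hzero : ∀ i : Fin 3, Complex.normSq (∑ μ, (shearRow x₀ i μ : ℂ) * f μ) = 0 := by
    intro i
    exact (Finset.sum_eq_zero_iff_of_nonneg (fun j _ ↦ Complex.normSq_nonneg _)).1 hre i
      (Finset.mem_univ i)
  have hcomp : ∀ i : Fin 3, f i.succ = (x₀ i.succ : ℂ) / (x₀ 0 : ℂ) * f 0 := by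
    intro i
    have h := Complex.normSq_eq_zero.1 (hzero i)
    simp only [shearRow, Fin.sum_univ_four] at h
    fin_cases i <;> (simp at h ⊢; linear_combination h)
  refine ⟨f 0 / (x₀ 0 : ℂ), funext fun μ ↦ ?_⟩
  have hx0 : (x₀ 0 : ℂ) ≠ 0 := Complex.ofReal_ne_zero.2 h0
  refine Fin.cases ?_ (fun i ↦ ?_) μ
  · simp only [Pi.smul_apply, smul_eq_mul]
    field_simp
  · rw [Pi.smul_apply, smul_eq_mul, hcomp i]
    field_simp

end InitialHessian

/-! ### The Hessian of the phase along the geodesic: Sbierski's Riccati construction applied -/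

section Riccati

open Literature.Analysis.ODE.GaussianBeamRiccati
open scoped Matrix.Norms.Operator ComplexConjugate

variable [Kerr.Facts] [Kerr.SliceFacts] {M a : ℝ}

/-- The velocity as a complex vector (the `x`-part of the tangent `σ̇` of the lift,
arXiv:1311.2477, §2.2, (2.26)). [cite: Sbierski2015, §3 (arXiv §2.2, (2.26))] -/
def velC (γ : ℝ → Kerr.exterior M a) (s : ℝ) : Fin 4 → ℂ := fun μ ↦ (vel γ s μ : ℂ)

variable (M a) in
/-- `ṗ` as a complex vector (the `p`-part of the tangent `σ̇` of the lift, (2.26)).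
[cite: Sbierski2015, §3 (arXiv §2.2, (2.26))] -/
def momentumRHSC (γ : ℝ → Kerr.exterior M a) (s : ℝ) : Fin 4 → ℂ :=
  fun κ ↦ (momentumRHS M a (γ s) (momentum M a γ s) κ : ℂ)

variable (M a) in
/-- `A(s)` along the lift of `γ`, as a complex matrix. [cite: Sbierski2015, §3 (arXiv §2.2, (2.17))] -/
def jacobiAC (γ : ℝ → Kerr.exterior M a) (s : ℝ) : Matrix (Fin 4) (Fin 4) ℂ :=
  (jacobiA M a (γ s) (momentum M a γ s)).map (fun r : ℝ ↦ (r : ℂ))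

variable (M a) in
/-- `B(s)` along the lift of `γ`, as a complex matrix. [cite: Sbierski2015, §3 (arXiv §2.2, (2.18))] -/
def jacobiBC (γ : ℝ → Kerr.exterior M a) (s : ℝ) : Matrix (Fin 4) (Fin 4) ℂ :=
  (jacobiB M a (γ s) (momentum M a γ s)).map (fun r : ℝ ↦ (r : ℂ))

variable (M a) in
/-- `C(s)` along `γ`, as a complex matrix. [cite: Sbierski2015, §3 (arXiv §2.2, (2.19))] -/
def jacobiCC (γ : ℝ → Kerr.exterior M a) (s : ℝ) : Matrix (Fin 4) (Fin 4) ℂ :=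
  (jacobiC M a (γ s)).map (fun r : ℝ ↦ (r : ℂ))

omit [Kerr.Facts] [Kerr.SliceFacts] in
/-- A real matrix viewed as a complex one is fixed by conjugation. [folklore] -/
theorem map_ofReal_map_conj {m : Type*} (X : Matrix m m ℝ) :
    ((X.map fun r : ℝ ↦ (r : ℂ)).map conj) = X.map fun r : ℝ ↦ (r : ℂ) := by
  ext i j
  simp only [Matrix.map_apply, Complex.conj_ofReal]

omit [Kerr.Facts] [Kerr.SliceFacts] in
/-- Transposition commutes with the passage to complex entries. [folklore] -/
theorem transpose_map_ofReal {m : Type*} (X : Matrix m m ℝ) :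
    (X.map fun r : ℝ ↦ (r : ℂ))ᵀ = Xᵀ.map fun r : ℝ ↦ (r : ℂ) :=
  Matrix.transpose_map.symm

omit [Kerr.Facts] [Kerr.SliceFacts] in
/-- A complexified real matrix applied to the complexified velocity. [folklore] -/
theorem map_ofReal_mulVec_velC (X : Matrix (Fin 4) (Fin 4) ℝ) (γ : ℝ → Kerr.exterior M a) (s : ℝ)
    (κ : Fin 4) :
    ((X.map fun r : ℝ ↦ (r : ℂ)) *ᵥ velC γ s) κ = ((∑ μ, X κ μ * vel γ s μ : ℝ) : ℂ) := by
  simp only [Matrix.mulVec, dotProduct, Matrix.map_apply, velC]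
  push_cast
  rfl

omit [Kerr.Facts] [Kerr.SliceFacts] in
/-- A complexified real matrix applied to the complexified `ṗ`. [folklore] -/
theorem map_ofReal_mulVec_momentumRHSC (X : Matrix (Fin 4) (Fin 4) ℝ) (γ : ℝ → Kerr.exterior M a)
    (s : ℝ) (κ : Fin 4) :
    ((X.map fun r : ℝ ↦ (r : ℂ)) *ᵥ momentumRHSC M a γ s) κ =
      ((∑ μ, X κ μ * momentumRHS M a (γ s) (momentum M a γ s) μ : ℝ) : ℂ) := by
  simp only [Matrix.mulVec, dotProduct, Matrix.map_apply, momentumRHSC]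
  push_cast
  rfl

/-- **The tangent of the lift solves the Jacobi system, `x`-part**:
`(γ̇)˙ = Bᵀ γ̇ + C ṗ` as complex vectors. [cite: Sbierski2015, §3 (arXiv §2.2, (2.26)–(2.27))] -/
theorem hasDerivAt_velC {γ : ℝ → Kerr.exterior M a}
    (hγ : IsGeodesic (Kerr.smoothMetric M a (Kerr.rPlus M a)).leviCivita γ) (s : ℝ) :
    HasDerivAt (velC γ)
      ((jacobiBC M a γ s)ᵀ *ᵥ velC γ s + jacobiCC M a γ s *ᵥ momentumRHSC M a γ s) s := by
  refine hasDerivAt_pi.2 fun ρ ↦ ?_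
  refine ((hasDerivAt_vel_jacobi hγ s ρ).ofReal_comp).congr_deriv ?_
  rw [Pi.add_apply, jacobiBC, transpose_map_ofReal, map_ofReal_mulVec_velC, jacobiCC,
    map_ofReal_mulVec_momentumRHSC]
  push_cast
  simp only [Matrix.transpose_apply]

/-- **The tangent of the lift solves the Jacobi system, `p`-part**:
`(ṗ)˙ = −A γ̇ − B ṗ` as complex vectors. [cite: Sbierski2015, §3 (arXiv §2.2, (2.26)–(2.27))] -/
theorem hasDerivAt_momentumRHSC {γ : ℝ → Kerr.exterior M a}
    (hγ : IsGeodesic (Kerr.smoothMetric M a (Kerr.rPlus M a)).leviCivita γ) (s : ℝ) :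
    HasDerivAt (momentumRHSC M a γ)
      (-(jacobiAC M a γ s *ᵥ velC γ s) - jacobiBC M a γ s *ᵥ momentumRHSC M a γ s) s := by
  refine hasDerivAt_pi.2 fun κ ↦ ?_
  refine ((hasDerivAt_momentumRHS hγ s κ).ofReal_comp).congr_deriv ?_
  rw [Pi.sub_apply, Pi.neg_apply, jacobiAC, map_ofReal_mulVec_velC, jacobiBC,
    map_ofReal_mulVec_momentumRHSC]
  push_cast
  rfl

omit [Kerr.Facts] [Kerr.SliceFacts] in
/-- The complexified velocity of a future-directed curve (`γ̇⁰ > 0`) is nonzero. [folklore] -/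
theorem velC_ne_zero {γ : ℝ → Kerr.exterior M a} {s : ℝ} (h : 0 < vel γ s 0) : velC γ s ≠ 0 := by
  intro h0
  have h1 := congrFun h0 0
  simp only [velC, Pi.zero_apply, Complex.ofReal_eq_zero] at h1
  exact h.ne' h1

/-- `A(s)` is continuous along the geodesic. [folklore] -/
theorem continuous_jacobiAC {γ : ℝ → Kerr.exterior M a}
    (hγ : IsGeodesic (Kerr.smoothMetric M a (Kerr.rPlus M a)).leviCivita γ) :
    Continuous (jacobiAC M a γ) :=
  continuous_matrix fun κ l ↦ Complex.continuous_ofReal.comp (contDiff_jacobiA hγ κ l).continuous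

/-- `B(s)` is continuous along the geodesic. [folklore] -/
theorem continuous_jacobiBC {γ : ℝ → Kerr.exterior M a}
    (hγ : IsGeodesic (Kerr.smoothMetric M a (Kerr.rPlus M a)).leviCivita γ) :
    Continuous (jacobiBC M a γ) :=
  continuous_matrix fun κ l ↦ Complex.continuous_ofReal.comp (contDiff_jacobiB hγ κ l).continuous

/-- `C(s)` is continuous along the geodesic. [folklore] -/
theorem continuous_jacobiCC {γ : ℝ → Kerr.exterior M a}
    (hγ : IsGeodesic (Kerr.smoothMetric M a (Kerr.rPlus M a)).leviCivita γ) :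
    Continuous (jacobiCC M a γ) :=
  continuous_matrix fun κ l ↦ Complex.continuous_ofReal.comp (contDiff_jacobiC hγ κ l).continuous

/-- The entries of `A`, `B`, `C` (complexified) are smooth on every open set. [folklore] -/
theorem contDiffOn_jacobi_entries {γ : ℝ → Kerr.exterior M a}
    (hγ : IsGeodesic (Kerr.smoothMetric M a (Kerr.rPlus M a)).leviCivita γ) (U : Set ℝ) :
    (∀ i k, ContDiffOn ℝ ∞ (fun t ↦ jacobiAC M a γ t i k) U) ∧
      (∀ i k, ContDiffOn ℝ ∞ (fun t ↦ jacobiBC M a γ t i k) U) ∧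
      (∀ i k, ContDiffOn ℝ ∞ (fun t ↦ jacobiCC M a γ t i k) U) := by
  refine ⟨fun i k ↦ ?_, fun i k ↦ ?_, fun i k ↦ ?_⟩
  · exact (Complex.ofRealCLM.contDiff.comp (contDiff_jacobiA hγ i k)).contDiffOn
  · exact (Complex.ofRealCLM.contDiff.comp (contDiff_jacobiB hγ i k)).contDiffOn
  · exact (Complex.ofRealCLM.contDiff.comp (contDiff_jacobiC hγ i k)).contDiffOn

/-- **The Hessian of the phase of a Gaussian beam along a null geodesic of the Kerr exterior
exists globally** (Sbierski, Anal. PDE 8 (2015), §3 = arXiv:1311.2477 §2.2, pp. 12–14, the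
construction of "the second derivatives of `φ`"): for a geodesic `γ` of the exterior with
`γ̇⁰ > 0` there is `M : ℝ → Mat₄(ℂ)`, symmetric, solving the Riccati equation
`Ṁ = −A − BM − MBᵀ − MCM` with the Hamiltonian data `A, B, C` of the lift of `γ`
((2.17)–(2.19), (2.23)), compatible with the first derivatives (`M γ̇ = ṗ`, (2.21)), with
`Im M ≥ 0` of kernel exactly `ℂ γ̇(s)` ((2.12)/(3.3): positive definite transversally), and with
`C^∞` entries. Proof: `Literature.Analysis.ODE.GaussianBeamRiccati.exists_riccati` with the
Jacobi data of this file, the tangent `(γ̇, ṗ)` of the lift as the transported vector solution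
(`hasDerivAt_velC`, `hasDerivAt_momentumRHSC`) and `M(0) = initialHessian γ̇(0) ṗ(0)`.
[cite: Sbierski2015, §3 (arXiv §2.2, pp. 12–14)] -/
theorem exists_phaseHessian {γ : ℝ → Kerr.exterior M a}
    (hγ : IsGeodesic (Kerr.smoothMetric M a (Kerr.rPlus M a)).leviCivita γ)
    (htime : ∀ s, 0 < vel γ s 0) :
    ∃ Mx : ℝ → Matrix (Fin 4) (Fin 4) ℂ,
      (∀ s, (Mx s)ᵀ = Mx s) ∧
      (∀ s i k, HasDerivAt (fun σ ↦ Mx σ i k)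
        ((-jacobiAC M a γ s - jacobiBC M a γ s * Mx s - Mx s * (jacobiBC M a γ s)ᵀ -
          Mx s * jacobiCC M a γ s * Mx s) i k) s) ∧
      (∀ s, Mx s *ᵥ velC γ s = momentumRHSC M a γ s) ∧
      (∀ s g, 0 ≤ (imForm (Mx s) g).re) ∧
      (∀ s g, imForm (Mx s) g = 0 → ∃ z : ℂ, g = z • velC γ s) ∧
      (∀ i k, ContDiff ℝ ∞ (fun t ↦ Mx t i k)) := by
  set x₀ : Fin 4 → ℝ := fun μ ↦ vel γ 0 μ with hx₀
  set ξ₀ : Fin 4 → ℝ := fun κ ↦ momentumRHS M a (γ 0) (momentum M a γ 0) κ with hξ₀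
  have h0 : x₀ 0 ≠ 0 := (htime 0).ne'
  obtain ⟨Mx, -, hsymm, -, hcompat, -, hnonneg, hker, hder, hsmooth⟩ :=
    exists_riccati (n := Fin 4) (continuous_jacobiAC hγ) (continuous_jacobiBC hγ)
      (continuous_jacobiCC hγ)
      (fun s ↦ by rw [jacobiAC, transpose_map_ofReal,
        jacobiA_transpose (Kerr.radius_pos_of_mem_region (γ s).2)])
      (fun s ↦ by rw [jacobiCC, transpose_map_ofReal, jacobiC_transpose])
      (fun s ↦ map_ofReal_map_conj _) (fun s ↦ map_ofReal_map_conj _)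
      (fun s ↦ map_ofReal_map_conj _)
      (hasDerivAt_velC hγ) (hasDerivAt_momentumRHSC hγ) (fun s ↦ velC_ne_zero (htime s))
      (initialHessian_transpose x₀ ξ₀) (initialHessian_mulVec h0 ξ₀)
      (fun f hf ↦ eq_smul_of_imForm_initialHessian_eq_zero h0 ξ₀ f hf)
  obtain ⟨hA, hB, hC⟩ := contDiffOn_jacobi_entries hγ univ
  refine ⟨Mx, hsymm, hder, hcompat, hnonneg (imForm_initialHessian_nonneg x₀ ξ₀), hker,
    fun i k ↦ ?_⟩
  exact contDiffOn_univ.1 (hsmooth univ isOpen_univ hA hB hC i k)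

end Riccati

/-! ### The phase Hessian as a definite object, and transversal positivity of its imaginary part -/

section PhaseHessian

open Literature.Analysis.ODE.GaussianBeamRiccati
open scoped Matrix.Norms.Operator ComplexConjugate

variable [Kerr.Facts] [Kerr.SliceFacts] {M a : ℝ} {γ : ℝ → Kerr.exterior M a}

/-- **The Hessian `M(s) = ∂∂φ(γ(s))` of the phase of the Gaussian beams along `γ`** (a choice of
the matrix path of `exists_phaseHessian`; Sbierski, arXiv:1311.2477, §2.2, pp. 12–14).
[cite: Sbierski2015, §3 (arXiv §2.2, pp. 12–14)] -/
def phaseHessian (hγ : IsGeodesic (Kerr.smoothMetric M a (Kerr.rPlus M a)).leviCivita γ)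
    (htime : ∀ s, 0 < vel γ s 0) : ℝ → Matrix (Fin 4) (Fin 4) ℂ :=
  Classical.choose (exists_phaseHessian hγ htime)

variable (hγ : IsGeodesic (Kerr.smoothMetric M a (Kerr.rPlus M a)).leviCivita γ)
  (htime : ∀ s, 0 < vel γ s 0)

/-- `M(s)` is symmetric. [cite: Sbierski2015, §3 (arXiv §2.2, p. 14)] -/
theorem phaseHessian_transpose (s : ℝ) : (phaseHessian hγ htime s)ᵀ = phaseHessian hγ htime s :=
  (Classical.choose_spec (exists_phaseHessian hγ htime)).1 s

/-- **`M` solves the Riccati equation** `Ṁ = −A − BM − MBᵀ − MCM` entrywise ((2.23)).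
[cite: Sbierski2015, §3 (arXiv §2.2, (2.23))] -/
theorem hasDerivAt_phaseHessian (s : ℝ) (i k : Fin 4) :
    HasDerivAt (fun σ ↦ phaseHessian hγ htime σ i k)
      ((-jacobiAC M a γ s - jacobiBC M a γ s * phaseHessian hγ htime s -
        phaseHessian hγ htime s * (jacobiBC M a γ s)ᵀ -
        phaseHessian hγ htime s * jacobiCC M a γ s * phaseHessian hγ htime s) i k) s :=
  (Classical.choose_spec (exists_phaseHessian hγ htime)).2.1 s i k

/-- **Compatibility `M(s) γ̇(s) = ṗ(s)`** ((2.21)). [cite: Sbierski2015, §3 (arXiv §2.2, (2.21))] -/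
theorem phaseHessian_mulVec (s : ℝ) :
    phaseHessian hγ htime s *ᵥ velC γ s = momentumRHSC M a γ s :=
  (Classical.choose_spec (exists_phaseHessian hγ htime)).2.2.1 s

/-- `Im M(s) ≥ 0`. [cite: Sbierski2015, §3 (arXiv §2.2, p. 14)] -/
theorem imForm_phaseHessian_nonneg (s : ℝ) (g : Fin 4 → ℂ) :
    0 ≤ (imForm (phaseHessian hγ htime s) g).re :=
  (Classical.choose_spec (exists_phaseHessian hγ htime)).2.2.2.1 s g

/-- The kernel of `Im M(s)` is `ℂ γ̇(s)`. [cite: Sbierski2015, §3 (arXiv §2.2, p. 14)] -/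
theorem eq_smul_of_imForm_phaseHessian_eq_zero (s : ℝ) (g : Fin 4 → ℂ)
    (h : imForm (phaseHessian hγ htime s) g = 0) : ∃ z : ℂ, g = z • velC γ s :=
  (Classical.choose_spec (exists_phaseHessian hγ htime)).2.2.2.2.1 s g h

/-- The entries of `M` are smooth. [cite: Sbierski2015, §3 (arXiv §2.2, p. 14)] -/
theorem contDiff_phaseHessian (i k : Fin 4) : ContDiff ℝ ∞ (fun t ↦ phaseHessian hγ htime t i k) :=
  (Classical.choose_spec (exists_phaseHessian hγ htime)).2.2.2.2.2 i k

omit [Kerr.Facts] [Kerr.SliceFacts] in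
/-- **The imaginary part of the spatial block as a real quadratic form**:
`y ↦ ∑_{ij} Im M_{i+1, j+1} y_i y_j` on `ℝ³` (the transversal directions of the leaves
`{t* = const}`). [cite: Sbierski2015, §3 (arXiv §2.2, (2.12)–(2.13))] -/
def imBlockForm (Mx : Matrix (Fin 4) (Fin 4) ℂ) (y : Fin 3 → ℝ) : ℝ :=
  ∑ i : Fin 3, ∑ j : Fin 3, (Mx i.succ j.succ).im * y i * y j

omit [Kerr.Facts] [Kerr.SliceFacts] in
/-- On purely spatial real vectors the Hermitian form of `Im M` is the real quadratic form of the
spatial block. [folklore] -/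
theorem imForm_spatial (Mx : Matrix (Fin 4) (Fin 4) ℂ) (y : Fin 3 → ℝ) :
    imForm Mx (Fin.cases 0 fun i ↦ (y i : ℂ)) = (imBlockForm Mx y : ℂ) := by
  rw [imForm_eq_sum, Fin.sum_univ_succ, imBlockForm]
  simp only [Fin.cases_zero, zero_mul, mul_zero, Finset.sum_const_zero, zero_add,
    Fin.sum_univ_succ (n := 3), Fin.cases_succ, star_zero]
  push_cast
  refine Finset.sum_congr rfl fun i _ ↦ Finset.sum_congr rfl fun j _ ↦ ?_
  rw [Complex.star_def, Complex.conj_ofReal]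
  ring

omit [Kerr.Facts] [Kerr.SliceFacts] in
/-- Homogeneity of the block form. [folklore] -/
theorem imBlockForm_smul (Mx : Matrix (Fin 4) (Fin 4) ℂ) (t : ℝ) (y : Fin 3 → ℝ) :
    imBlockForm Mx (t • y) = t ^ 2 * imBlockForm Mx y := by
  simp only [imBlockForm, Pi.smul_apply, smul_eq_mul, Finset.mul_sum]
  exact Finset.sum_congr rfl fun i _ ↦ Finset.sum_congr rfl fun j _ ↦ by ring

/-- **Transversal positivity of `Im M(s)`**: the imaginary part of the spatial block of the phase
Hessian is positive definite on `ℝ³` for every `s` — the kernel of `Im M(s)` is the line of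
`γ̇(s)`, which is transversal to the leaves since `γ̇⁰ > 0` (Sbierski, arXiv:1311.2477, §2.2,
(2.12): "`Im(∇∇φ|_γ)` is positive definite on a 3-dimensional subspace transversal to `γ̇`").
[cite: Sbierski2015, §3 (arXiv §2.2, (2.12))] -/
theorem imBlockForm_pos (s : ℝ) {y : Fin 3 → ℝ} (hy : y ≠ 0) :
    0 < imBlockForm (phaseHessian hγ htime s) y := by
  set g : Fin 4 → ℂ := Fin.cases 0 fun i ↦ (y i : ℂ) with hg_def
  have hg : imForm (phaseHessian hγ htime s) g = (imBlockForm (phaseHessian hγ htime s) y : ℂ) :=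
    imForm_spatial _ y
  have hnonneg : 0 ≤ imBlockForm (phaseHessian hγ htime s) y := by
    have h := imForm_phaseHessian_nonneg hγ htime s g
    rwa [hg, Complex.ofReal_re] at h
  rcases hnonneg.lt_or_eq with h | h
  · exact h
  exfalso
  have hzero : imForm (phaseHessian hγ htime s) g = 0 := by
    rw [hg, ← h, Complex.ofReal_zero]
  obtain ⟨z, hz⟩ := eq_smul_of_imForm_phaseHessian_eq_zero hγ htime s g hzero
  have h0 := congrFun hz 0
  simp only [hg_def, Fin.cases_zero, Pi.smul_apply, smul_eq_mul, velC] at h0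
  have hz0 : z = 0 := by
    rcases mul_eq_zero.1 h0.symm with h1 | h1
    · exact h1
    · exact absurd (Complex.ofReal_eq_zero.1 h1) (htime s).ne'
  apply hy
  funext i
  have hi := congrFun hz i.succ
  simp only [hg_def, Fin.cases_succ, Pi.smul_apply, hz0, zero_smul] at hi
  exact_mod_cast hi

omit [Kerr.Facts] [Kerr.SliceFacts] in
/-- Continuity of the block form of a path with continuous entries, jointly in `(s, y)`. [folklore] -/
theorem continuous_imBlockForm {Mx : ℝ → Matrix (Fin 4) (Fin 4) ℂ}
    (hMx : ∀ i k, Continuous fun t ↦ Mx t i k) :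
    Continuous fun q : ℝ × (Fin 3 → ℝ) ↦ imBlockForm (Mx q.1) q.2 := by
  unfold imBlockForm
  refine continuous_finsetSum _ fun i _ ↦ continuous_finsetSum _ fun j _ ↦ ?_
  exact ((Complex.continuous_im.comp ((hMx i.succ j.succ).comp continuous_fst)).mul
    ((continuous_apply i).comp continuous_snd)).mul ((continuous_apply j).comp continuous_snd)

/-- **Uniform transversal positivity on compact parameter intervals**: on `[S₁, S₂]` the
imaginary part of the spatial block of the phase Hessian is bounded below by `c ∑ y_i²`, `c > 0`
(continuity and compactness; this is the constant `c` of Sbierski's (2.13),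
`Im φ(x) ≥ c (x₁² + x₂² + x₃²)` near `γ`). [cite: Sbierski2015, §3 (arXiv §2.2, (2.13))] -/
theorem exists_imBlockForm_ge (S₁ S₂ : ℝ) :
    ∃ c : ℝ, 0 < c ∧ ∀ s ∈ Icc S₁ S₂, ∀ y : Fin 3 → ℝ,
      c * ∑ i, y i ^ 2 ≤ imBlockForm (phaseHessian hγ htime s) y := by
  set Q : ℝ × (Fin 3 → ℝ) → ℝ := fun q ↦ imBlockForm (phaseHessian hγ htime q.1) q.2 with hQ
  have hQc : Continuous Q :=
    continuous_imBlockForm fun i k ↦ (contDiff_phaseHessian hγ htime i k).continuous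
  set K : Set (ℝ × (Fin 3 → ℝ)) := Icc S₁ S₂ ×ˢ Metric.sphere (0 : Fin 3 → ℝ) 1 with hK
  have hKc : IsCompact K := isCompact_Icc.prod (isCompact_sphere _ _)
  -- sup-norm bound `∑ y_i² ≤ 3 ‖y‖²`
  have hsum : ∀ y : Fin 3 → ℝ, ∑ i, y i ^ 2 ≤ 3 * ‖y‖ ^ 2 := by
    intro y
    have h : ∀ i, y i ^ 2 ≤ ‖y‖ ^ 2 := fun i ↦ by
      rw [← sq_abs]
      exact pow_le_pow_left₀ (abs_nonneg _) (by simpa using norm_le_pi_norm y i) 2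
    calc ∑ i, y i ^ 2 ≤ ∑ _i : Fin 3, ‖y‖ ^ 2 := Finset.sum_le_sum fun i _ ↦ h i
      _ = 3 * ‖y‖ ^ 2 := by simp
  by_cases hne : K.Nonempty
  · obtain ⟨q₀, hq₀, hmin⟩ := hKc.exists_isMinOn hne hQc.continuousOn
    have hpos : 0 < Q q₀ := by
      have hy₀ : q₀.2 ≠ 0 := by
        intro h0
        have h := (Set.mem_prod.1 hq₀).2
        rw [mem_sphere_zero_iff_norm, h0, norm_zero] at h
        exact zero_ne_one h
      exact imBlockForm_pos hγ htime q₀.1 hy₀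
    refine ⟨Q q₀ / 3, by positivity, fun s hs y ↦ ?_⟩
    by_cases hy : y = 0
    · subst hy
      simp [imBlockForm]
    · have hny : 0 < ‖y‖ := norm_pos_iff.2 hy
      have hmem : (s, ‖y‖⁻¹ • y) ∈ K := by
        refine Set.mem_prod.2 ⟨hs, ?_⟩
        rw [mem_sphere_zero_iff_norm, norm_smul, norm_inv, norm_norm, inv_mul_cancel₀ hny.ne']
      have hle : Q q₀ ≤ imBlockForm (phaseHessian hγ htime s) (‖y‖⁻¹ • y) := hmin hmem
      rw [imBlockForm_smul] at hle
      have hscale : imBlockForm (phaseHessian hγ htime s) y =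
          ‖y‖ ^ 2 * (‖y‖⁻¹ ^ 2 * imBlockForm (phaseHessian hγ htime s) y) := by
        field_simp
      rw [hscale]
      calc Q q₀ / 3 * ∑ i, y i ^ 2 ≤ Q q₀ / 3 * (3 * ‖y‖ ^ 2) := by gcongr; exact hsum y
        _ = ‖y‖ ^ 2 * Q q₀ := by ring
        _ ≤ ‖y‖ ^ 2 * (‖y‖⁻¹ ^ 2 * imBlockForm (phaseHessian hγ htime s) y) := by gcongr
  · refine ⟨1, one_pos, fun s hs y ↦ ?_⟩
    exfalso
    apply hne
    refine ⟨(s, Pi.single 0 1), Set.mem_prod.2 ⟨hs, ?_⟩⟩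
    rw [mem_sphere_zero_iff_norm]
    simp [Pi.norm_single]

end PhaseHessian

end GaussianBeam

end Literature.Barriers.FinalStateConjecture

end
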